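import Summits.FinalStateConjecture.FinalStateConjecture.Theorems.SwallowTheDatumUniversalWitnessFamilyThroatSettlesToo
import Summits.FinalStateConjecture.FinalStateConjecture.Theorems.SwallowTheDatumParametricKerrBurialCollarLine
import Summits.FinalStateConjecture.FinalStateConjecture.Theorems.SwallowTheDatumUniversalWitnessFamilyStubSocketDilation
import Summits.FinalStateConjecture.FinalStateConjecture.Theorems.SwallowTheDatumUniversalWitnessFamilyStubSocketTransportPatch
import Summits.FinalStateConjecture.FinalStateConjecture.Theorems.SwallowTheDatumUniversalWitnessFamilyStubSheetBreathing
import Summits.FinalStateConjecture.FinalStateConjecture.Theorems.SwallowTheDatumUniversalWitnessFamilySheetLine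
import HarnessLib

/-!
# Line `Sketch` (= idea `throat-settles-too`) — skeleton v5 for the crux
# `SwallowTheDatum.UniversalWitnessFamily` (item stmt-FinalStateConjecture-10051)

Continuation lead `prover-line-stmt-FinalStateConjecture-10051-c1-0`, 2026-08-16.  Reshape of the first lead's v4
(`Cruxes/UniversalWitnessFamily/Lines/Sketch.lean`): the six S-side stubs of v1–v4 are LANDED and the S-side composition
is the landed `Theorems.SwallowTheDatum.UniversalWitnessFamily.ThroatSettlesToo.settles_core`; the one remaining stub of v4,
the monolithic d-side engine `stub_throatBurial` (XL, gluing), is here RESHAPED into five registered stubs along the house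
pattern of crux 10052's collar lines (`Theorems/SwallowTheDatumParametricKerrBurial{Line,CollarLine}.lean`):

* TWO ANALYTIC ATOMS (not provable inside the tree today; honest debt of the line):
  `stub_farGluing` — crux 10052's registered `stub_farGluing` VERBATIM (Mao–Oh–Tao arXiv:2308.13031 Thm 1.7/1.10:
  receding far-annulus gluing of `d` onto a growing exact isotropic Schwarzschild(`m_R ≥ ηR`) seed, smooth in `R`; one
  proof serves both cruxes), and `stub_socketBag` — the d-FREE universal SOCKET BAG: a vacuum datum on `ℝ³` minus the
  unit ball which is exactly weak-field isotropic Schwarzschild(`μ`), `k = 0`, on the socket annulus `{1 < ‖y‖ < 2}`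
  (`μ ≤ μ₀` as small as wanted) and exactly isotropic Schwarzschild(`M`), `k = 0`, on the OPEN exterior sheet
  `{‖y‖ > M/2}`, `M > 4` (between them: the bag — Beig–Ó Murchadha's critical two-puncture blow-up `(aG_p + bG_q)⁴ g̃`
  of a Yamabe-positive `S³` flat near `p, q`, made exact at both weak-field junctions by MOT Thm 1.7; Penrose/PMT
  consistent: each end sees an exact Schwarzschild exterior of its own mass down to its own horizon, the junk sits
  behind BOTH horizons).
* THREE GEOMETRIC STUBS (provable now, templates = 10052's landed `stub_collarDilationB`, `stub_transportPatchB`,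
  `stub_breathing`, whose only shield-specific lemmas are to be redone for the SHEET shield):
  `stub_socketDilation` (the dilates of a socket bag are socket bags), `stub_socketTransportPatch` (patch the far-glued
  `G R` with the dilated bag across the Schwarzschild(`m_R`) annulus; the member is admissible and SHEET-SHIELDED),
  `stub_sheetBreathing` (injectivity device; sheet shields are diffeomorphism invariant).

SHIELD OF THE LINE, v5: `IsSheetShielded X D` — the open-sheet presentation that `settles_core` actually consumes
(an open embedding `Φ : {‖y‖ > M/2} → X` with injective differentials, co-compact far zones and
`Φ^* D = timeSymmetricExteriorData M` EXACTLY).  It is implied by v4's `IsThroatShielded` (`sheet_presentation`) and is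
all the S-side uses: exactness is required on the open exterior sheet only, nothing at or inside the horizon.

## Composition (sorry-free; `UniversalWitnessFamily_of` is the ONLY declaration concluding the crux decl)

`SheetBurial_of` : farGluing → socketBag → socketDilation → socketTransportPatch → sheetBreathing → SheetBurial
(first-order plumbing + the landed `junction` lemma, verbatim the proof of `ParametricKerrBurial_of_collarLine`);
`settlesInEveryMGHD_ofSheet` : `SubdataDevelopmentsEmbed` (10053) + the landed `settles_core`, `stub_exteriorTransport`,
`stub_scriTransfer` give the ∀-MGHD clauses of `P` for a sheet-shielded member; `UniversalWitnessFamily_of` :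
`MGHDExists` (9937) → `SubdataDevelopmentsEmbed` (10053) → the five stubs → `UniversalWitnessFamily`.

## Disproof used (`Cruxes/UniversalWitnessFamily/Disproof.lean`, cdisprove cycle 1 FINAL, NO KILL; unchanged since v4)

§3 `uwf_false_without_memAdmissible` / `_without_constraints`: every member admissible (transport-patch conclusion);
`uwfWithoutNeZero_iff`: only `c ≠ 0` members shielded; `uwfWithoutT2_false_of`: `[T2Space X]` kept.  §5: this IS a
receding witness (`junction`: `R(c) = R⋆ + 1 + ‖c‖⁻²`).  §6 `settledIn_minkowski`: template of the landed region-I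
decomposition.  No `-- Targets` entry concerns the v5 stubs.
-/

set_option linter.dupNamespace false

noncomputable section

namespace Summit.FinalStateConjecture.FinalStateConjecture.Cruxes.UniversalWitnessFamily.ThroatSettlesToo

open scoped Manifold ContDiff Topology
open Bundle Set Filter Function Literature.Geometry.Lorentzian
open Summit.FinalStateConjecture.FinalStateConjecture.Theses.SwallowTheDatum
  (UniversalWitnessFamily MGHDExists SubdataDevelopmentsEmbed)
open Summit.FinalStateConjecture.FinalStateConjecture.Theorems.SwallowTheDatum.ParametricKerrBurial
  (SmoothSectionsOn AgreeAt IsExactSchwarzschildBeyond IsSchwarzschildAnnulus junction VacuumOn IsIsotropicBeyond)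
open Summit.FinalStateConjecture.FinalStateConjecture.Theorems.SwallowTheDatum.UniversalWitnessFamily.ThroatSettlesToo
  (settles_core)

/-! ## §0 Vocabulary of the line (v5) -/

section Vocabulary

variable (X : Type) [TopologicalSpace X] [ChartedSpace E3 X] [IsManifold (𝓡 3) ∞ X]

/-- `D` on `X` is **sheet-shielded**: for some mass `M > 0` there is an open embedding `Φ` of the OPEN exterior sheet
`{‖y‖ > M/2}` of the isotropic Schwarzschild slice into `X`, with injective differentials and co-compact far zones,
along which `D` pulls back EXACTLY to the time-symmetric exterior data `((1 + M/2‖y‖)⁴ δ, 0)`.  This is the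
conclusion of the landed `sheet_presentation` (so every throat-shielded datum of v1–v4 is sheet-shielded) and the
input of the landed `settles_core`. -/
def IsSheetShielded (D : InitialDataSet (𝓡 3) X) : Prop :=
  ∃ (M : ℝ) (hM : 0 < M) (Φ : Schwarzschild.isotropicExterior M → X)
    (hΦ : ContMDiff (𝓡 3) (𝓡 3) (∞ + 1) Φ) (hΦ' : ∀ u, Function.Injective (mfderiv (𝓡 3) (𝓡 3) Φ u)),
    Topology.IsOpenEmbedding Φ ∧
    (∀ R' : ℝ, M / 2 ≤ R' → IsCompact (Φ '' {y : Schwarzschild.isotropicExterior M | R' < ‖(y : E3)‖})ᶜ) ∧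
    D.comap Φ hΦ hΦ' = Schwarzschild.timeSymmetricExteriorData M hM.le

/-- **SheetBurial** (the d-side engine's output, v5): through every admissible datum passes a jointly smooth,
injective, admissible one-parameter family whose members off `c = 0` are sheet-shielded. -/
def SheetBurial : Prop :=
  ∀ (X : Type) [TopologicalSpace X] [ChartedSpace E3 X] [IsManifold (𝓡 3) ∞ X]
    [T2Space X] [SecondCountableTopology X] [ConnectedSpace X],
    ∀ d ∈ admissibleVacuumData X, ∃ F : EuclideanSpace ℝ (Fin 1) → InitialDataSet (𝓡 3) X,
      InitialDataSet.IsSmoothDataFamily 1 F ∧ F 0 = d ∧ Function.Injective F ∧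
      (∀ c, F c ∈ admissibleVacuumData X) ∧ ∀ c ≠ 0, IsSheetShielded X (F c)

end Vocabulary

/-! ## §1 The five stub STATEMENTS (`Sig.stub_<name> : Prop`; the registered theorems of §2 restate them verbatim) -/

/-- **Stub A — `stub_farGluing` (XL analytic atom; = crux 10052's registered `stub_farGluing` VERBATIM).** Through every
admissible `d` on `X`: a sole end `e`, a threshold `R⋆`, a smooth mass function `m R ≥ ηR` and a family `G R`,
jointly smooth on `{R⋆ < R} × X`, of ADMISSIBLE data equal to `d` off `e.far R` and EXACTLY isotropic
Schwarzschild(`m R`), `k = 0`, beyond chart radius `32R`.  Mao–Oh–Tao arXiv:2308.13031 Thm 1.7 (obstruction-free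
annular gluing, `s = 2`, in = `d(R·)`, out = Schwarzschild(`η′`), `ΔE` window) + Rem 1.9 (persistence of regularity);
the smooth dependence on `R` is the unprinted atom. [cite: MaoOhTao2023, Thm 1.7, Rem 1.8–1.11] -/
def Sig.stub_farGluing : Prop :=
  ∀ (X : Type) [TopologicalSpace X] [ChartedSpace E3 X] [IsManifold (𝓡 3) ∞ X] [T2Space X]
    [SecondCountableTopology X] [ConnectedSpace X], ∀ d ∈ admissibleVacuumData X,
    ∃ (η : ℝ) (e : AFEnd X) (Rstar : ℝ) (m : ℝ → ℝ) (G : ℝ → InitialDataSet (𝓡 3) X),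
      0 < η ∧ e.IsSoleEnd ∧ e.R < Rstar ∧ ContDiff ℝ ∞ m ∧
      SmoothSectionsOn 𝓘(ℝ, ℝ) G {p : ℝ × X | Rstar < p.1} ∧
      ∀ R : ℝ, Rstar < R → G R ∈ admissibleVacuumData X ∧ (∀ x ∉ e.far R, AgreeAt (G R) d x) ∧
        η * R ≤ m R ∧ IsExactSchwarzschildBeyond e (G R) (m R) (32 * R)

/-- **Stub B — `stub_socketBag` (XL analytic atom, d-FREE; the UNIVERSAL SOCKET BAG).** For every `μ₀ > 0` there are
`0 < μ ≤ μ₀`, `M > 4` and a datum `C` on `ℝ³` which solves the vacuum constraints OUTSIDE the unit ball, is EXACTLY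
`((1 + μ/2‖y‖)⁴ δ, 0)` on the socket annulus `{1 < ‖y‖ < 2}` (weak field, sheet-1 orientation: the plug side is
`{‖y‖ < 1}`, the bag side `{‖y‖ > 2}`) and EXACTLY `((1 + M/2‖y‖)⁴ δ, 0)` on the open exterior sheet `{‖y‖ > M/2}`.
Paper construction: Beig–Ó Murchadha critical blow-up of a Yamabe-positive `(S³, g̃)` flat near two points, conformal
factor `aG_p + bG_q` with `a/b → 0` and regular part `A_q → ∞` (the socket is `p`'s sheet-2 side, the shield `q`'s
exterior sheet), both weak-field junctions made exact by Mao–Oh–Tao Thm 1.7 (time-symmetric in/out: `ΔP = ΔJ = 0`,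
`ΔC` killed by recentring, `ΔE` by the mass choice).  The combination is not in print. [cite: BeigOMurchadha1991]
[cite: MaoOhTao2023, Thm 1.7] [cite: Corvino2000, Thm 1] -/
def Sig.stub_socketBag : Prop :=
  ∀ μ₀ : ℝ, 0 < μ₀ → ∃ μ : ℝ, 0 < μ ∧ μ ≤ μ₀ ∧
    ∃ (M : ℝ) (C : InitialDataSet (𝓡 3) E3), 4 < M ∧
      VacuumOn {y : E3 | 1 < ‖y‖} C ∧ IsSchwarzschildAnnulus C μ ∧ IsIsotropicBeyond M (M / 2) C

/-- **Stub C1 — `stub_socketDilation` (M; template `stub_collarDilationB`).** The dilates `C_l = ((y ↦ y/l)^* C).homothety l`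
(`h_l(y) = h(y/l)`, `k_l(y) = l⁻¹ k(y/l)`, `InitialDataDilation.lean`) of a socket bag form a family with sections jointly
smooth on `{0 < l} × ℝ³` whose members are socket bags at scale `l`: vacuum outside the ball of radius `l`, socket annulus
Schwarzschild(`lμ`) on `{l < ‖y‖ < 2l}`, exterior sheet Schwarzschild(`lM`) beyond `lM/2`. Bartnik–Isenberg 2004 §2
(equivariance/homothety covariance of the constraints). [cite: BartnikIsenberg2004, §2] -/
def Sig.stub_socketDilation : Prop :=
  ∀ (C : InitialDataSet (𝓡 3) E3) (μ M : ℝ), 0 < μ → 4 < M →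
    VacuumOn {y : E3 | 1 < ‖y‖} C → IsSchwarzschildAnnulus C μ → IsIsotropicBeyond M (M / 2) C →
    ∃ Cfam : ℝ → InitialDataSet (𝓡 3) E3,
      SmoothSectionsOn 𝓘(ℝ, ℝ) Cfam {p : ℝ × E3 | 0 < p.1} ∧
      ∀ l : ℝ, 0 < l →
        VacuumOn {y : E3 | l < ‖y‖} (Cfam l) ∧
        (∀ y : E3, l < ‖y‖ → ‖y‖ < 2 * l →
          (Cfam l).h.inner y = (1 + l * μ / (2 * ‖y‖)) ^ 4 • (innerSL ℝ : E3 →L[ℝ] E3 →L[ℝ] ℝ) ∧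
            (Cfam l).k y = 0) ∧
        IsIsotropicBeyond (l * M) (l * M / 2) (Cfam l)

/-- **Stub C2 — `stub_socketTransportPatch` (L; template `stub_transportPatchB`).** With `l(R) := m R/μ ≥ 32R`, the datum
`P R := G R` inside / `coord^*(Cfam (l R))` beyond chart radius `5l/4` (`AFEnd.annulusPatch`: both prescriptions are
`((1 + m R/2r)⁴δ, 0)` on `{5l/4 < ‖coord‖ < 7l/4}`) is admissible (vacuum by locality; the end is the transplanted exact
isotropic end of the bag, `exists_end_of_isIsotropicBeyond`), SHEET-SHIELDED (chart `Φₑ ∘ incl : {‖y‖ > lM/2} → X` through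
the chart of the sole end `e`, `lM/2 > 2l > 5l/4`; co-compact far zones by `IsSoleEnd.isCompact_compl_far`), equal to
`G R` off `e.far (32R)`, and jointly smooth in `(R, x)`. Corvino 2000 §4; Bartnik 1986 §1. [folklore] -/
def Sig.stub_socketTransportPatch : Prop :=
  ∀ (X : Type) [TopologicalSpace X] [ChartedSpace E3 X] [IsManifold (𝓡 3) ∞ X] [T2Space X]
    [SecondCountableTopology X] [ConnectedSpace X] (e : AFEnd X) (Rstar η μ M : ℝ) (m : ℝ → ℝ)
    (G : ℝ → InitialDataSet (𝓡 3) X) (Cfam : ℝ → InitialDataSet (𝓡 3) E3),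
    e.IsSoleEnd → e.R < Rstar → 0 < μ → 32 * μ ≤ η → 4 < M → ContDiff ℝ ∞ m →
    SmoothSectionsOn 𝓘(ℝ, ℝ) G {p : ℝ × X | Rstar < p.1} →
    (∀ R : ℝ, Rstar < R → G R ∈ admissibleVacuumData X ∧ η * R ≤ m R ∧
      IsExactSchwarzschildBeyond e (G R) (m R) (32 * R)) →
    SmoothSectionsOn 𝓘(ℝ, ℝ) Cfam {p : ℝ × E3 | 0 < p.1} →
    (∀ l : ℝ, 0 < l →
      VacuumOn {y : E3 | l < ‖y‖} (Cfam l) ∧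
      (∀ y : E3, l < ‖y‖ → ‖y‖ < 2 * l →
        (Cfam l).h.inner y = (1 + l * μ / (2 * ‖y‖)) ^ 4 • (innerSL ℝ : E3 →L[ℝ] E3 →L[ℝ] ℝ) ∧
          (Cfam l).k y = 0) ∧
      IsIsotropicBeyond (l * M) (l * M / 2) (Cfam l)) →
    ∃ P : ℝ → InitialDataSet (𝓡 3) X, SmoothSectionsOn 𝓘(ℝ, ℝ) P {p : ℝ × X | Rstar < p.1} ∧
      ∀ R : ℝ, Rstar < R → P R ∈ admissibleVacuumData X ∧
        (∃ (M' : ℝ) (hM' : 0 < M') (Φ : Schwarzschild.isotropicExterior M' → X)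
          (hΦ : ContMDiff (𝓡 3) (𝓡 3) (∞ + 1) Φ) (hΦ' : ∀ u, Function.Injective (mfderiv (𝓡 3) (𝓡 3) Φ u)),
          Topology.IsOpenEmbedding Φ ∧
          (∀ R' : ℝ, M' / 2 ≤ R' →
            IsCompact (Φ '' {y : Schwarzschild.isotropicExterior M' | R' < ‖(y : E3)‖})ᶜ) ∧
          (P R).comap Φ hΦ hΦ' = Schwarzschild.timeSymmetricExteriorData M' hM'.le) ∧
        ∀ x ∉ e.far (32 * R), AgreeAt (P R) (G R) x

/-- **Stub C3 — `stub_sheetBreathing` (M; template `stub_breathing`).** The two-parameter family `S (R, t) = Φ_t^* (P R)`,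
the one-parameter comparison family `E t = Φ_t^* d` through `d`, and an injective marker, where `Φ_t` are the breathing
diffeomorphisms supported in a coordinate ball of the shell `{R < ‖coord‖ < R⋆}` (`AFEndBreathingData.lean`); sheet
shields are invariant under pullback by diffeomorphisms (chart `Φ_t⁻¹ ∘ Φ`). [folklore] -/
def Sig.stub_sheetBreathing : Prop :=
  ∀ (X : Type) [TopologicalSpace X] [ChartedSpace E3 X] [IsManifold (𝓡 3) ∞ X] [T2Space X]
    [SecondCountableTopology X] [ConnectedSpace X] (d : InitialDataSet (𝓡 3) X) (e : AFEnd X) (Rstar : ℝ)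
    (P : ℝ → InitialDataSet (𝓡 3) X), e.R < Rstar →
    SmoothSectionsOn 𝓘(ℝ, ℝ) P {p : ℝ × X | Rstar < p.1} →
    (∀ R : ℝ, Rstar < R → P R ∈ admissibleVacuumData X ∧
      (∃ (M' : ℝ) (hM' : 0 < M') (Φ : Schwarzschild.isotropicExterior M' → X)
        (hΦ : ContMDiff (𝓡 3) (𝓡 3) (∞ + 1) Φ) (hΦ' : ∀ u, Function.Injective (mfderiv (𝓡 3) (𝓡 3) Φ u)),
        Topology.IsOpenEmbedding Φ ∧
        (∀ R' : ℝ, M' / 2 ≤ R' →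
          IsCompact (Φ '' {y : Schwarzschild.isotropicExterior M' | R' < ‖(y : E3)‖})ᶜ) ∧
        (P R).comap Φ hΦ hΦ' = Schwarzschild.timeSymmetricExteriorData M' hM'.le) ∧
      ∀ x ∉ e.far R, AgreeAt (P R) d x) →
    ∃ (S : ℝ × ℝ → InitialDataSet (𝓡 3) X) (E : ℝ → InitialDataSet (𝓡 3) X) (x₀ : X)
      (v₀ : TangentSpace (𝓡 3) x₀),
      SmoothSectionsOn (𝓘(ℝ, ℝ).prod 𝓘(ℝ, ℝ)) S {p : (ℝ × ℝ) × X | Rstar < p.1.1} ∧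
      SmoothSectionsOn 𝓘(ℝ, ℝ) E (Set.univ : Set (ℝ × X)) ∧ E 0 = d ∧
      (∀ R t : ℝ, Rstar < R → ∀ x ∉ e.far R, AgreeAt (S (R, t)) (E t) x) ∧ x₀ ∉ e.far Rstar ∧
      Set.InjOn (fun t : ℝ ↦ (E t).h.inner x₀ v₀ v₀) (Set.Ioo (-1) 1) ∧
      ∀ R t : ℝ, Rstar < R → |t| < 1 → S (R, t) ∈ admissibleVacuumData X ∧
        ∃ (M' : ℝ) (hM' : 0 < M') (Φ : Schwarzschild.isotropicExterior M' → X)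
          (hΦ : ContMDiff (𝓡 3) (𝓡 3) (∞ + 1) Φ) (hΦ' : ∀ u, Function.Injective (mfderiv (𝓡 3) (𝓡 3) Φ u)),
          Topology.IsOpenEmbedding Φ ∧
          (∀ R' : ℝ, M' / 2 ≤ R' →
            IsCompact (Φ '' {y : Schwarzschild.isotropicExterior M' | R' < ‖(y : E3)‖})ᶜ) ∧
          (S (R, t)).comap Φ hΦ hΦ' = Schwarzschild.timeSymmetricExteriorData M' hM'.le

/-! ## §2 The registered stubs (theorem bodies = the `Sig` bodies verbatim) — v5.1: C1–C3 LANDED and wired by name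
(`Theorems.SwallowTheDatum.UniversalWitnessFamily.stub_{socketDilation,socketTransportPatch,sheetBreathing}`, p97873 / p98701 / p98109);
`sorry` remains only in the two analytic atoms `stub_farGluing` (shared with 10052) and `stub_socketBag` -/

/-- **STUB A** (XL analytic atom; shared verbatim with crux 10052): receding far-annulus gluing. -/
theorem stub_farGluing :
  ∀ (X : Type) [TopologicalSpace X] [ChartedSpace E3 X] [IsManifold (𝓡 3) ∞ X] [T2Space X]
    [SecondCountableTopology X] [ConnectedSpace X], ∀ d ∈ admissibleVacuumData X,
    ∃ (η : ℝ) (e : AFEnd X) (Rstar : ℝ) (m : ℝ → ℝ) (G : ℝ → InitialDataSet (𝓡 3) X),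
      0 < η ∧ e.IsSoleEnd ∧ e.R < Rstar ∧ ContDiff ℝ ∞ m ∧
      SmoothSectionsOn 𝓘(ℝ, ℝ) G {p : ℝ × X | Rstar < p.1} ∧
      ∀ R : ℝ, Rstar < R → G R ∈ admissibleVacuumData X ∧ (∀ x ∉ e.far R, AgreeAt (G R) d x) ∧
        η * R ≤ m R ∧ IsExactSchwarzschildBeyond e (G R) (m R) (32 * R) := by
  sorry

/-- **STUB B** (XL analytic atom, d-free): the universal socket bag. -/
theorem stub_socketBag :
  ∀ μ₀ : ℝ, 0 < μ₀ → ∃ μ : ℝ, 0 < μ ∧ μ ≤ μ₀ ∧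
    ∃ (M : ℝ) (C : InitialDataSet (𝓡 3) E3), 4 < M ∧
      VacuumOn {y : E3 | 1 < ‖y‖} C ∧ IsSchwarzschildAnnulus C μ ∧ IsIsotropicBeyond M (M / 2) C := by
  sorry

/-- **STUB C1** (M): the dilates of a socket bag are socket bags. -/
theorem stub_socketDilation :
  ∀ (C : InitialDataSet (𝓡 3) E3) (μ M : ℝ), 0 < μ → 4 < M →
    VacuumOn {y : E3 | 1 < ‖y‖} C → IsSchwarzschildAnnulus C μ → IsIsotropicBeyond M (M / 2) C →
    ∃ Cfam : ℝ → InitialDataSet (𝓡 3) E3,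
      SmoothSectionsOn 𝓘(ℝ, ℝ) Cfam {p : ℝ × E3 | 0 < p.1} ∧
      ∀ l : ℝ, 0 < l →
        VacuumOn {y : E3 | l < ‖y‖} (Cfam l) ∧
        (∀ y : E3, l < ‖y‖ → ‖y‖ < 2 * l →
          (Cfam l).h.inner y = (1 + l * μ / (2 * ‖y‖)) ^ 4 • (innerSL ℝ : E3 →L[ℝ] E3 →L[ℝ] ℝ) ∧
            (Cfam l).k y = 0) ∧
        IsIsotropicBeyond (l * M) (l * M / 2) (Cfam l) :=
  Summit.FinalStateConjecture.FinalStateConjecture.Theorems.SwallowTheDatum.UniversalWitnessFamily.stub_socketDilation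

/-- **STUB C2** (L): transport-and-patch; the member is admissible and sheet-shielded. -/
theorem stub_socketTransportPatch :
  ∀ (X : Type) [TopologicalSpace X] [ChartedSpace E3 X] [IsManifold (𝓡 3) ∞ X] [T2Space X]
    [SecondCountableTopology X] [ConnectedSpace X] (e : AFEnd X) (Rstar η μ M : ℝ) (m : ℝ → ℝ)
    (G : ℝ → InitialDataSet (𝓡 3) X) (Cfam : ℝ → InitialDataSet (𝓡 3) E3),
    e.IsSoleEnd → e.R < Rstar → 0 < μ → 32 * μ ≤ η → 4 < M → ContDiff ℝ ∞ m →
    SmoothSectionsOn 𝓘(ℝ, ℝ) G {p : ℝ × X | Rstar < p.1} →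
    (∀ R : ℝ, Rstar < R → G R ∈ admissibleVacuumData X ∧ η * R ≤ m R ∧
      IsExactSchwarzschildBeyond e (G R) (m R) (32 * R)) →
    SmoothSectionsOn 𝓘(ℝ, ℝ) Cfam {p : ℝ × E3 | 0 < p.1} →
    (∀ l : ℝ, 0 < l →
      VacuumOn {y : E3 | l < ‖y‖} (Cfam l) ∧
      (∀ y : E3, l < ‖y‖ → ‖y‖ < 2 * l →
        (Cfam l).h.inner y = (1 + l * μ / (2 * ‖y‖)) ^ 4 • (innerSL ℝ : E3 →L[ℝ] E3 →L[ℝ] ℝ) ∧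
          (Cfam l).k y = 0) ∧
      IsIsotropicBeyond (l * M) (l * M / 2) (Cfam l)) →
    ∃ P : ℝ → InitialDataSet (𝓡 3) X, SmoothSectionsOn 𝓘(ℝ, ℝ) P {p : ℝ × X | Rstar < p.1} ∧
      ∀ R : ℝ, Rstar < R → P R ∈ admissibleVacuumData X ∧
        (∃ (M' : ℝ) (hM' : 0 < M') (Φ : Schwarzschild.isotropicExterior M' → X)
          (hΦ : ContMDiff (𝓡 3) (𝓡 3) (∞ + 1) Φ) (hΦ' : ∀ u, Function.Injective (mfderiv (𝓡 3) (𝓡 3) Φ u)),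
          Topology.IsOpenEmbedding Φ ∧
          (∀ R' : ℝ, M' / 2 ≤ R' →
            IsCompact (Φ '' {y : Schwarzschild.isotropicExterior M' | R' < ‖(y : E3)‖})ᶜ) ∧
          (P R).comap Φ hΦ hΦ' = Schwarzschild.timeSymmetricExteriorData M' hM'.le) ∧
        ∀ x ∉ e.far (32 * R), AgreeAt (P R) (G R) x :=
  Summit.FinalStateConjecture.FinalStateConjecture.Theorems.SwallowTheDatum.UniversalWitnessFamily.stub_socketTransportPatch

/-- **STUB C3** (M): breathing (injectivity device); sheet shields are diffeomorphism invariant. -/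
theorem stub_sheetBreathing :
  ∀ (X : Type) [TopologicalSpace X] [ChartedSpace E3 X] [IsManifold (𝓡 3) ∞ X] [T2Space X]
    [SecondCountableTopology X] [ConnectedSpace X] (d : InitialDataSet (𝓡 3) X) (e : AFEnd X) (Rstar : ℝ)
    (P : ℝ → InitialDataSet (𝓡 3) X), e.R < Rstar →
    SmoothSectionsOn 𝓘(ℝ, ℝ) P {p : ℝ × X | Rstar < p.1} →
    (∀ R : ℝ, Rstar < R → P R ∈ admissibleVacuumData X ∧
      (∃ (M' : ℝ) (hM' : 0 < M') (Φ : Schwarzschild.isotropicExterior M' → X)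
        (hΦ : ContMDiff (𝓡 3) (𝓡 3) (∞ + 1) Φ) (hΦ' : ∀ u, Function.Injective (mfderiv (𝓡 3) (𝓡 3) Φ u)),
        Topology.IsOpenEmbedding Φ ∧
        (∀ R' : ℝ, M' / 2 ≤ R' →
          IsCompact (Φ '' {y : Schwarzschild.isotropicExterior M' | R' < ‖(y : E3)‖})ᶜ) ∧
        (P R).comap Φ hΦ hΦ' = Schwarzschild.timeSymmetricExteriorData M' hM'.le) ∧
      ∀ x ∉ e.far R, AgreeAt (P R) d x) →
    ∃ (S : ℝ × ℝ → InitialDataSet (𝓡 3) X) (E : ℝ → InitialDataSet (𝓡 3) X) (x₀ : X)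
      (v₀ : TangentSpace (𝓡 3) x₀),
      SmoothSectionsOn (𝓘(ℝ, ℝ).prod 𝓘(ℝ, ℝ)) S {p : (ℝ × ℝ) × X | Rstar < p.1.1} ∧
      SmoothSectionsOn 𝓘(ℝ, ℝ) E (Set.univ : Set (ℝ × X)) ∧ E 0 = d ∧
      (∀ R t : ℝ, Rstar < R → ∀ x ∉ e.far R, AgreeAt (S (R, t)) (E t) x) ∧ x₀ ∉ e.far Rstar ∧
      Set.InjOn (fun t : ℝ ↦ (E t).h.inner x₀ v₀ v₀) (Set.Ioo (-1) 1) ∧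
      ∀ R t : ℝ, Rstar < R → |t| < 1 → S (R, t) ∈ admissibleVacuumData X ∧
        ∃ (M' : ℝ) (hM' : 0 < M') (Φ : Schwarzschild.isotropicExterior M' → X)
          (hΦ : ContMDiff (𝓡 3) (𝓡 3) (∞ + 1) Φ) (hΦ' : ∀ u, Function.Injective (mfderiv (𝓡 3) (𝓡 3) Φ u)),
          Topology.IsOpenEmbedding Φ ∧
          (∀ R' : ℝ, M' / 2 ≤ R' →
            IsCompact (Φ '' {y : Schwarzschild.isotropicExterior M' | R' < ‖(y : E3)‖})ᶜ) ∧
          (S (R, t)).comap Φ hΦ hΦ' = Schwarzschild.timeSymmetricExteriorData M' hM'.le :=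
  Summit.FinalStateConjecture.FinalStateConjecture.Theorems.SwallowTheDatum.UniversalWitnessFamily.stub_sheetBreathing

/-! ## §3 The compositions (all proved; no `sorry` of their own) -/

/-- **`SheetBurial` from the five stubs of the line** (first-order plumbing; verbatim the proof of 10052's landed
`ParametricKerrBurial_of_collarLine` with the sheet shield in place of the Kerr shield): far gluing gives `η, e, R⋆, m, G`;
the socket bag at `μ₀ := η/32` the bag `C` with `32μ ≤ η`; dilation the family `Cfam`; transport + patch the
radius-indexed admissible sheet-shielded family `P` with `P R = d` off `e.far R` (`far_mono`); breathing the families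
`S, E` and the marker; the landed `junction` lemma the typed family `F`. -/
theorem SheetBurial_of :
    Sig.stub_farGluing → Sig.stub_socketBag → Sig.stub_socketDilation → Sig.stub_socketTransportPatch →
      Sig.stub_sheetBreathing → SheetBurial := by
  intro hA hU hDil hPatch hBreathe X _ _ _ _ _ _ d hd
  obtain ⟨η, e, Rstar, m, G, hη, hsole, heR, hm, hGs, hG⟩ := hA X d hd
  obtain ⟨μ, hμ, hμle, M, C, hM4, hvac, hann, hiso⟩ := hU (η / 32) (by positivity)
  have h32 : 32 * μ ≤ η := by linarith
  obtain ⟨Cfam, hCs, hCfam⟩ := hDil C μ M hμ hM4 hvac hann hiso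
  obtain ⟨P, hPs, hP⟩ := hPatch X e Rstar η μ M m G Cfam hsole heR hμ h32 hM4 hm hGs
    (fun R hR ↦ ⟨(hG R hR).1, (hG R hR).2.2.1, (hG R hR).2.2.2⟩) hCs hCfam
  have hRpos : ∀ R : ℝ, Rstar < R → 0 ≤ R := fun R hR ↦ by linarith [e.R_pos]
  have hPd : ∀ R : ℝ, Rstar < R → P R ∈ admissibleVacuumData X ∧
      (∃ (M' : ℝ) (hM' : 0 < M') (Φ : Schwarzschild.isotropicExterior M' → X)
        (hΦ : ContMDiff (𝓡 3) (𝓡 3) (∞ + 1) Φ) (hΦ' : ∀ u, Function.Injective (mfderiv (𝓡 3) (𝓡 3) Φ u)),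
        Topology.IsOpenEmbedding Φ ∧
        (∀ R' : ℝ, M' / 2 ≤ R' →
          IsCompact (Φ '' {y : Schwarzschild.isotropicExterior M' | R' < ‖(y : E3)‖})ᶜ) ∧
        (P R).comap Φ hΦ hΦ' = Schwarzschild.timeSymmetricExteriorData M' hM'.le) ∧
      ∀ x ∉ e.far R, AgreeAt (P R) d x := by
    intro R hR
    refine ⟨(hP R hR).1, (hP R hR).2.1, fun x hx ↦ ?_⟩
    have hx' : x ∉ e.far (32 * R) := fun h ↦ hx (e.far_mono (by nlinarith [hRpos R hR]) h)
    obtain ⟨h1, h2⟩ := (hP R hR).2.2 x hx'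
    obtain ⟨h3, h4⟩ := (hG R hR).2.1 x hx
    exact ⟨h1.trans h3, h2.trans h4⟩
  obtain ⟨S, E, x₀, v₀, hSs, hEs, hE0, hSE, hx₀, hmark, hgood⟩ := hBreathe X d e Rstar P heR hPs hPd
  obtain ⟨F, hF, hF0, hFinj, hmem⟩ := junction d e Rstar S E x₀ v₀ hSs hEs hE0 hSE hx₀ hmark
  refine ⟨F, hF, hF0, hFinj, fun c ↦ ?_, fun c hc ↦ ?_⟩
  · by_cases hc : c = 0
    · subst hc; rw [hF0]; exact hd
    · obtain ⟨R, t, hR, ht, hFc⟩ := hmem c hc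
      rw [hFc]; exact (hgood R t hR ht).1
  · obtain ⟨R, t, hR, ht, hFc⟩ := hmem c hc
    rw [hFc]; exact (hgood R t hR ht).2

/-- **The ∀-MGHD clauses of `P` for ONE sheet-shielded member** (the content of the planner's `ThroatShieldedSettles`,
v5 form): `SubdataDevelopmentsEmbed` (10053) specialised to the sheet chart, the landed generic lever
`stub_exteriorTransport`, the landed scri lever `stub_scriTransfer` and the landed `settles_core` (which consumes the six
landed S-side stubs) give, in every MAXIMAL vacuum Cauchy development of the member, complete `𝓘⁺` and an exhaustive
sub-extremal decomposition of the self-determined exterior. -/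
theorem settlesInEveryMGHD_ofSheet (hE : SubdataDevelopmentsEmbed)
    (X : Type) [TopologicalSpace X] [ChartedSpace E3 X] [IsManifold (𝓡 3) ∞ X]
    [T2Space X] [SecondCountableTopology X] [ConnectedSpace X]
    (D : InitialDataSet (𝓡 3) X) (hsh : IsSheetShielded X D)
    (𝒟 : VacuumCauchyDevelopment D) (hmax : 𝒟.IsMaximal) :
    Summit.FinalStateConjecture.HasCompleteNullInfinity 𝒟.toCauchyDevelopment ∧
      ∃ (O : Set 𝒟.carrier) (dec : FinalStateDecomposition 𝒟.toSpacetime O 2),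
        (∀ i, Kerr.IsSubextremal (dec.mass i) (dec.spin i)) ∧
          O = Summit.FinalStateConjecture.exteriorOf 𝒟.toCauchyDevelopment dec.charted ∧
            Summit.FinalStateConjecture.HasExhaustiveCharts dec := by
  haveI : Kerr.Facts :=
    ⟨Kerr.isConnected_region_holds, Kerr.contMDiff_bilin_holds, Kerr.contMDiff_timeVector_holds⟩
  obtain ⟨M, hM, Φ', hΦ', hΦ'', hopen, hfar, hdata⟩ := hsh
  exact settles_core 𝒟 hM hopen hfar hdata
    (hE X D 𝒟 hmax (Schwarzschild.isotropicExterior M) Φ' hΦ' hΦ'' hopen)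
    (Summit.FinalStateConjecture.FinalStateConjecture.Theorems.SwallowTheDatum.UniversalWitnessFamily.stub_exteriorTransport
      X D 𝒟.toCauchyDevelopment (Schwarzschild.isotropicExterior M) Φ' hΦ' hΦ'' hopen)
    (Summit.FinalStateConjecture.FinalStateConjecture.Theorems.PhaseMixingCapture.WeakCosmicCensorshipMGHD.stub_scriTransfer
      X D 𝒟.toCauchyDevelopment (Schwarzschild.isotropicExterior M) Φ' hΦ' hΦ'' hopen)

/-- **THE SKELETON THEOREM — the five stub statements (+ the route items `MGHDExists` (9937) and
`SubdataDevelopmentsEmbed` (10053), BY NAME, and the landed S-side of the line) conclude the crux BY NAME** (the ONLY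
declaration of the file whose conclusion is the crux decl):
`MGHDExists → SubdataDevelopmentsEmbed → Sig.stub_farGluing → Sig.stub_socketBag → Sig.stub_socketDilation →
Sig.stub_socketTransportPatch → Sig.stub_sheetBreathing → UniversalWitnessFamily`. -/
theorem UniversalWitnessFamily_of :
    MGHDExists → SubdataDevelopmentsEmbed → Sig.stub_farGluing → Sig.stub_socketBag → Sig.stub_socketDilation →
      Sig.stub_socketTransportPatch → Sig.stub_sheetBreathing → UniversalWitnessFamily := by
  intro hM hE hA hU hDil hPatch hBr X _ _ _ _ _ _ d hd
  obtain ⟨F, hF, h0, hinj, hadm, hsh⟩ := SheetBurial_of hA hU hDil hPatch hBr X d hd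
  refine ⟨F, hF, h0, hinj, hadm, fun c hc ↦ ⟨hM X (F c) (hadm c), ?_⟩⟩
  intro 𝒟 h𝒟
  exact settlesInEveryMGHD_ofSheet hE X (F c) (hsh c hc) 𝒟 h𝒟

/-- The skeleton instantiated (an `example`, so `UniversalWitnessFamily_of` stays the unique crux-concluding
declaration): the crux from the five registered stubs, sorried through them only, with the two route items as
hypotheses. -/
example (hM : MGHDExists) (hE : SubdataDevelopmentsEmbed) : UniversalWitnessFamily :=
  UniversalWitnessFamily_of hM hE stub_farGluing stub_socketBag stub_socketDilation stub_socketTransportPatch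
    stub_sheetBreathing

end Summit.FinalStateConjecture.FinalStateConjecture.Cruxes.UniversalWitnessFamily.ThroatSettlesToo

end
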